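import Literature.Computability.ImplicitComplexity.SoftTypeAssignmentFreeVars
import HarnessLib

/-!
# Words are data of every `STA` string type `S_m` (`m ≥ 1`)

GMR08 (= Gaboardi–Marion–Ronchi Della Rocca 2008), §3.2: "Strings of booleans are represented by
terms of the shape `λcz.c b₀ (⋯ (c bₙ z)⋯)` … typable by the indexed types
`S_i ≐ ∀α.!ⁱ(B ⊸ α ⊸ α) ⊸ α ⊸ α`", data being typed "through derivations with degree `0`". The
tree (`SoftTypeAssignment.lean`, `STA.typing_encWord`) proves `⊢ s̲ : S₁`; programs of
`SoftSumRepresentsAtLevel` have type `!ⁿ S_m ⊸ B` for any `m ≥ 1`, so the soundness theorem needs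
`⊢ s̲ : S_m` for every `m ≥ 1`: after the multiplexor contracting the `|s|` copies of the iterator
into one slot of type `!(B ⊸ α ⊸ α)`, `m - 1` further multiplexors of rank one raise it to
`!ᵐ(B ⊸ α ⊸ α)` (rule `(m)` with `n = 1` is dereliction read upside down). Proved here:

* `STA.typing_encWord_level` — `⊢ s̲ : S_m` with degree `0`, for all `m ≥ 1`;
* `STA.typing_app_encWord_level` — for a closed program `⊢ M : !ⁿ S_m ⊸ B` of degree `d`, the
  applied term `M s̲ : B` is typed with degree `max d n`.

## References

* [GaboardiMarionRonchidellarocca2008] GMR08, §3.2 (data types, degree 0), Table 2 `(m)`,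
  Def. 5.13.
-/

namespace Literature.Computability.ImplicitComplexity

namespace STA

open Finset

/-- The body of a word with every occurrence of the iterator at slot `q`:
`c b₀ (c b₁ (⋯ (c bₖ z)⋯))` with `c` the variable `q` and `z` the variable `0`. [cite: GaboardiMarionRonchidellarocca2008, §3.2] -/
def chainTo (q : ℕ) (w : List Bool) : Term :=
  w.foldr (fun b r => .app (.app (.var q) (encBit b)) r) (.var 0)

/-- `encWord w = λc.λz.(chainTo 1 w)`. [cite: GaboardiMarionRonchidellarocca2008, §3.2] -/
theorem encWord_eq_chainTo (w : List Bool) : encWord w = .lam (.lam (chainTo 1 w)) := rfl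

/-- Contracting the iterator copies of `wordChain` into the slot `q`. [cite: GaboardiMarionRonchidellarocca2008, Table 2 (m)] -/
theorem wordChain_rename_to (S : Finset ℕ) (q : ℕ) (h0 : 0 ∉ S) (bs : List Bool) (s : ℕ)
    (hS : ∀ i, s ≤ i → i < s + bs.length → i ∈ S) :
    (wordChain s bs).rename (mpxRen S q) = chainTo q bs := by
  induction bs generalizing s with
  | nil => simp [wordChain, chainTo, Term.rename, mpxRen, h0]
  | cons b bs ih =>
    have hs : s ∈ S := hS s le_rfl (by simp)
    simp only [wordChain, chainTo, Term.rename, mpxRen, hs, if_true, encBit_rename, List.foldr_cons]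
    rw [ih (s + 1) (fun i hi hi' => hS i (by omega) (by simp; omega))]
    rfl

/-- Moving the iterator of `chainTo` from slot `q ≠ 0` to slot `q'`. [folklore] -/
theorem chainTo_rename (q q' : ℕ) (hq : q ≠ 0) (w : List Bool) :
    (chainTo q w).rename (mpxRen {q} q') = chainTo q' w := by
  induction w with
  | nil => simp [chainTo, Term.rename, mpxRen, hq.symm]
  | cons b bs ih =>
    simp only [chainTo, List.foldr_cons, Term.rename, encBit_rename] at ih ⊢
    rw [ih]
    simp [mpxRen]

/-- The context `z : α, c : !ᵏ(B ⊸ α ⊸ α)` with the iterator at slot `p`. [folklore] -/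
def iterCtx (k p : ℕ) : Ctx := fun i =>
  if i = 0 then some ⟨0, .tvar 0⟩ else if i = p then some ⟨k, tyF⟩ else none

/-- `z : α, c : !ᵏ(B ⊸ α ⊸ α) ⊢ c b₀ (⋯ (c bₙ z)) : α` with degree `0`, the iterator at the fresh slot
`1 + |w| + k`, for every `k ≥ 1`: one multiplexor of rank `|w|`, then `k - 1` of rank one.
[cite: GaboardiMarionRonchidellarocca2008, §3.2 and Table 2 (m)] -/
theorem typing_chainTo_level (w : List Bool) : ∀ k : ℕ, 1 ≤ k →
    Typing 0 (iterCtx k (1 + w.length + k)) (chainTo (1 + w.length + k) w) ⟨0, .tvar 0⟩ := by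
  intro k hk
  induction k with
  | zero => omega
  | succ k ih =>
    rcases Nat.eq_zero_or_pos k with rfl | hkpos
    · -- the multiplexor of rank `|w|`
      refine Typing.mpx (Γ := wordCtx 2 (2 + w.length)) (σ := ⟨0, tyF⟩) (Finset.Ico 2 (2 + w.length))
        (1 + w.length + 1) (typing_wordChain w 2 (by omega))
        (fun i hi => wordCtx_of_mem (by have := Finset.mem_Ico.mp hi; omega) (Finset.mem_Ico.mp hi))
        (wordCtx_of_not_mem (by omega) (by omega)) ?_
        (wordChain_rename_to _ _ (by simp) w 2 (fun i hi hi' => by simp; omega)).symm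
      funext i
      by_cases h0 : i = 0
      · subst h0
        simp [iterCtx, Ctx.mpx, wordCtx_zero]
      · by_cases hp : i = 1 + w.length + 1
        · subst hp
          simp [iterCtx, Ctx.mpx, SoftTy.bang, tyF]
          omega
        · by_cases hI : 2 ≤ i ∧ i < 2 + w.length
          · simp [iterCtx, Ctx.mpx, h0, hp, hI]
          · simp [iterCtx, Ctx.mpx, h0, hp, hI, wordCtx_of_not_mem h0 hI]
    · -- one more multiplexor of rank one
      have ih' := ih hkpos
      refine Typing.mpx (σ := ⟨k, tyF⟩) {1 + w.length + k} (1 + w.length + (k + 1)) ih'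
        (fun i hi => by rw [Finset.mem_singleton] at hi; subst hi; simp [iterCtx]) (by simp [iterCtx]) ?_ ?_
      · funext i
        by_cases h0 : i = 0
        · subst h0
          simp [iterCtx, Ctx.mpx]
          omega
        · by_cases hp : i = 1 + w.length + (k + 1)
          · subst hp
            simp [iterCtx, Ctx.mpx, SoftTy.bang]
          · by_cases hq : i = 1 + w.length + k
            · subst hq
              simp [iterCtx, Ctx.mpx]
            · simp [iterCtx, Ctx.mpx, h0, hp, hq]
      · rw [chainTo_rename _ _ (by omega)]

/-- **Words are data of every string type**: `⊢ s̲ : S_m` with degree `0` for all `m ≥ 1`.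
[cite: GaboardiMarionRonchidellarocca2008, §3.2] -/
theorem typing_encWord_level (w : List Bool) (m : ℕ) (hm : 1 ≤ m) : Typing 0 Ctx.empty (encWord w) ⟨0, tyS m⟩ := by
  rcases Nat.lt_or_ge m 2 with h1 | h2
  · obtain rfl : m = 1 := by omega
    exact typing_encWord w
  · refine Typing.allI (Δ := Ctx.empty) ?_ rfl
    rw [encWord_eq_chainTo]
    refine Typing.lam (Typing.lam ?_)
    obtain ⟨m, rfl⟩ : ∃ m', m = m' + 1 := ⟨m - 1, by omega⟩
    refine Typing.mpx (σ := ⟨m, tyF⟩) {1 + w.length + m} 1 (typing_chainTo_level w m (by omega))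
      (fun i hi => by rw [Finset.mem_singleton] at hi; subst hi; simp [iterCtx]) (by simp [iterCtx]; omega) ?_ ?_
    · funext i
      rcases i with _ | _ | i
      · simp [Ctx.cons, Ctx.mpx, iterCtx]
        omega
      · simp [Ctx.cons, Ctx.mpx, SoftTy.bang, tyF]
        omega
      · by_cases hq : i + 2 = 1 + w.length + m
        · simp [Ctx.cons, Ctx.empty, Ctx.mpx, hq]
        · simp [Ctx.cons, Ctx.empty, Ctx.mpx, hq]
          simp [iterCtx, hq]
    · rw [chainTo_rename _ _ (by omega)]

/-- **The level of an applied program, any string type**: if `⊢ M : !ⁿ S_m ⊸ B` (`m ≥ 1`) with degree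
`d`, then `⊢ M s̲ : B` with degree `max d n` for every word `s`. [cite: GaboardiMarionRonchidellarocca2008, Table 2 ((sp), (⊸E)) and Def. 5.13] -/
theorem typing_app_encWord_level {d n m : ℕ} {M : Term} (h : Typing d Ctx.empty M (progTy n m)) (hm : 1 ≤ m)
    (w : List Bool) : Typing (max d n) Ctx.empty (.app M (encWord w)) ⟨0, tyB⟩ := by
  have hw : ∀ k, Typing k Ctx.empty (encWord w) ⟨k, tyS m⟩ := by
    intro k
    induction k with
    | zero => exact typing_encWord_level w m hm
    | succ k ih => exact Typing.sp ih rfl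
  exact Typing.app (fun _ => Or.inl ⟨rfl, rfl⟩) h (hw n)

end STA

end Literature.Computability.ImplicitComplexity
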